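/-
Copyright (c) 2026 the pub-hodgecm-mathlib formalisation cell (harness21).  Prover seat hodgecm-mathlib-R90-C14-p01 (g0), HCML SLAB R90-TF,
section S3 «§12.7 endoscopic character identities» (base `R90-C12`), deal S3-p17′ (J3b) — RULING S3-R16 (A′) of the successor S3 dealer
R90-C12-plan (g2), R90 bus 2026-09-04T23:04:12Z.  2026-09-04.
-/
import Summits.HodgeConjecture.HodgeConjecture.Theorems.R90S3FiniteExpansionParabolicIndGL3   -- ★ p862766: (J3) modulo the finite length `hFL`
import Literature.NumberTheory.Automorphic.ParabolicGLFiniteLengthProofs                     -- ★ `Representation.isFiniteLength_parabolicIndGL_holds` (BZ77 Thm. 2.8 / Rem. 2.10)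
import HarnessLib

/-!
# R90 · S3 — (J3b) DISCHARGED: THE UNCONDITIONAL FINITE `ℤ`-EXPANSION OF `tr (i_c r ∘ e′)` IN IRREDUCIBLE CHARACTERS OF `G′_v`
# (`Theorems/R90S3FiniteExpansionParabolicIndGL3Holds.lean`; pays hypothesis `hJ3` of ★ p862576 `R90.S3.print_4131b_vanDijkSplit_of` OUTRIGHT)

Cell `hodgecm-mathlib`, crux H413 (`stmt-HodgeConjecture-24833`), route of record `HCCMUnconditional`; programme R90-TF, section S3 (base `R90-C12`),
seat R90-C14-p01 (g0); deal S3-p17′, RULING S3-R16 (A′) (R90-C12-plan (g2) 23:04:12Z; census `R90/S3/CENSUS-J3b-finiteLength.R90-C14-p01-g0.md`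
5871b89e2dc2c9ef).  Helper lane `--supports stmt-HodgeConjecture-24833 --as helper`; ONE THEOREM (no definition, no instance, no notation, no `sorry`).

THE MATHEMATICS.  ★ p862766 `finiteExpansion_parabolicIndGL3_of_isFiniteLength` proves the `hJ3` bytes over the hypothesis
`hFL : ∀ w, c • w ≠ w → Representation.isFiniteLength_parabolicIndGL L_w (lastBlockLabel 3)` (finite length of parabolic induction on `GL₃(L_w)` from the
`(2,1)` Levi).  That hypothesis is the tree's ★ discharge `Representation.isFiniteLength_parabolicIndGL_holds`
(`Literature/NumberTheory/Automorphic/ParabolicGLFiniteLengthProofs.lean`; Bernstein–Zelevinsky 1977, Thm. 2.8 with Rem. 2.10: for EVERY admissible `σ` of finite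
length of a standard Levi of `GL_n(F)`, `i_c σ` has finite length — exactness reduction to irreducible `σ`, reindexing, finite generation by the big cell,
generators of a common level, «admissible + bounded level ⇒ finite length» via Jacquet modules).  Feeding it in gives the unconditional statement.
* **`finiteExpansion_parabolicIndGL3`** — `hJ3` of ★ p862576, token for token; junction pay term `‹J3› := R90.S3.finiteExpansion_parabolicIndGL3 L H′ v hH′ hH′d νG`.
HONEST LABEL: helper theorem; E's print socket 6 closes only by the E ED. 3 plug once (J1) is ★ as well.  HC_CM is proved only modulo the 7 printed citations
(2 remaining named inputs: hLiu418 = stmt-HodgeConjecture-24832, h413 = stmt-HodgeConjecture-24833) until rung 0 closes; count-neutral.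

## References
* [BernsteinZelevinsky1977] I. N. Bernstein, A. V. Zelevinsky, *Induced representations of reductive 𝔭-adic groups I*, Ann. Sci. ÉNS 10 (1977), §2.3, Thm. 2.8, Rem. 2.10.
* [Rogawski1990] J. D. Rogawski, *Automorphic Representations of Unitary Groups in Three Variables* (1990), §4.13 Lemma 4.13.1 (b) p. 64; §13.1 Thm. 13.1.1 (2) p. 198.
* [Casselman1995] W. Casselman, *Introduction to the theory of admissible representations of 𝔭-adic reductive groups* (1995), §2.1.
-/

-- the mandated namespace repeats the single-problem summit's segment (`HodgeConjecture.HodgeConjecture`)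
set_option linter.dupNamespace false
set_option autoImplicit false

noncomputable section

namespace Summit.HodgeConjecture.HodgeConjecture.R90.S3

open MeasureTheory IsDedekindDomain NumberField
open Literature.NumberTheory Literature.NumberTheory.Automorphic Literature.NumberTheory.Automorphic.UnitaryGroup
open Literature.NumberTheory.Rogawski1990 Literature.NumberTheory.GaloisRepresentations
open scoped Matrix

variable (L : Type) [Field L] [NumberField L] [IsCMField L] (H' : Matrix (Fin 3) (Fin 3) L)
  (v : HeightOneSpectrum (𝓞 ↥(maximalRealSubfield L)))

/-- **(J3) — THE FINITE `ℤ`-EXPANSION OF `tr (i_c r ∘ e′)` IN IRREDUCIBLE CHARACTERS OF `G′_v`, UNCONDITIONAL** (= hypothesis `hJ3` of ★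
`print_4131b_vanDijkSplit_of`, token for token): for every split `w ∣ v` and every irreducible smooth admissible `r` of the `(2,1)` block Levi of `GL₃(L_w)`
there is a finitely supported `c : IrrClass G′_v →₀ ℤ` with `tr ((i_c r) ∘ e′)(f dνG) = Σ_{π} c(π)·tr π(f dνG)` for all locally constant compactly supported `f` —
★ p862766 `finiteExpansion_parabolicIndGL3_of_isFiniteLength` over the ★ discharge `Representation.isFiniteLength_parabolicIndGL_holds` (finite length of
parabolic induction, Bernstein–Zelevinsky). [cite: BernsteinZelevinsky1977, §2.3, Thm. 2.8 and Remark 2.10] [cite: Rogawski1990, §4.13 Lemma 4.13.1 (b) p. 64; §13.1 Thm. 13.1.1 (2) p. 198]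
[cite: Casselman1995, §2.1] -/
theorem finiteExpansion_parabolicIndGL3
    (hH' : (H'.map (cmConjRingHom L))ᵀ = H') (hH'd : IsUnit H'.det)
    [MeasurableSpace ((UnitaryGroup.cmDatum L 3 H').Local v)] [BorelSpace ((UnitaryGroup.cmDatum L 3 H').Local v)]
    (νG : Measure ((UnitaryGroup.cmDatum L 3 H').Local v)) [νG.IsHaarMeasure] :
    ∀ (w : UnitaryGroup.PlacesOver L v) (hw : IsCMField.complexConj L • w.1 ≠ w.1)
      (r : SmoothIrrep (Π a, GL {i : Fin 3 // Zelevinsky1980.lastBlockLabel 3 i = a} (w.1.adicCompletion L))),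
      r.ρ.IsAdmissible →
      ∃ c : IrrClass ((UnitaryGroup.cmDatum L 3 H').Local v) →₀ ℤ,
        ∀ f : (UnitaryGroup.cmDatum L 3 H').Local v → ℂ, IsLocSmooth f →
          Representation.smoothTrace (G := (UnitaryGroup.cmDatum L 3 H').Local v)
            ((Representation.parabolicIndGL (w.1.adicCompletion L) (Zelevinsky1980.lastBlockLabel 3) r.ρ).comp
              (UnitaryGroup.localSplitEquiv (IsCMField.complexConj L) H' (IsCMField.complexConj_ne_one L)
                ((UnitaryGroup.map_cmConjRingHom_eq_map_complexConj L H') ▸ hH') w hw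
                (UnitaryGroup.isUnit_placeForm_of_isUnit_det hH'd w.1)).toMonoidHom) νG f =
            ∑ π ∈ c.support, (c π : ℂ) * π.smoothTrace νG f :=
  finiteExpansion_parabolicIndGL3_of_isFiniteLength L H' v hH' hH'd νG
    fun w _ => Representation.isFiniteLength_parabolicIndGL_holds (w.1.adicCompletion L) (Zelevinsky1980.lastBlockLabel 3)

end Summit.HodgeConjecture.HodgeConjecture.R90.S3

end
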